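import Literature.Computability.Cryptography.LWEPsiBarSampler
import Literature.Computability.Cryptography.LWESwitchKernelProgLaw
import Literature.Computability.Cryptography.SamplerCoinLaws
import HarnessLib

/-!
# The machine's `Ψ̄_Q(β)` sampler as a typed polynomial-time program, and its law on uniform coins

Topic `Computability/Cryptography` (LWE), grouping namespace `BLPRS2013.KProg`; sequel of `LWEPsiBarSampler.lean` (`psiValue`, `psiLaw`: the law-level
sampler `⌊κ̂G/2ᵇ⌉ mod Q` from an integer sampler, and its distance to `Ψ̄_Q(β)`) and companion of `LWESwitchKernelProg.lean`/`LWESwitchKernelProgLaw.lean` (the same bricks: the tree's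
pseudo-Gaussian sampler program `samplerOf`, exact rational arithmetic `ratRound`, `toNat_emod_eq_val`). This file writes ONE `Ψ̄` sample as a deterministic function of the coins,
in closed form and as a program against a record, proves the program typed polynomial time, and identifies its law on uniform coins with `psiLaw` read through
`ZMod.val` (everything PROVED; definitions with bodies; no named fact):

* `psiValueQ κ̂ b G = ⌊κ̂G/2ᵇ⌉` over `ℚ` (`= psiValue` of the law file, `psiValueQ_eq_psiValue`), `psiFlat Q κ̂ b PG coins` (the residue in `[0, Q)`),
  `PRec`/`pRecOf`, `psiOf` (the program), `psiOf_pRecOf`, **`psiOf_codeFP`**;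
* **`uniformVector_map_psiFlat`** — `(U {0,1}^C).map psiFlat = (psiLaw Q κ̂ b PG.lawPMF).map ZMod.val` for `coinLen ≤ C`.

## References

* Z. Brakerski, A. Langlois, C. Peikert, O. Regev, D. Stehlé, *Classical hardness of learning with errors*, STOC 2013; arXiv:1306.0281, Thm. 4.1 (proof) and §5.
  [BrakerskiEtAl2013]
* C. Peikert, *Public-key cryptosystems from the worst-case shortest vector problem*, STOC 2009, p. 7 (finite precision). [Peikert2009]
* S. Arora, B. Barak, *Computational Complexity: A Modern Approach*, CUP 2009, §1.3, Def. 7.1. [AroraBarak2009]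
-/

noncomputable section

open scoped ENNReal
open PMF Literature.Probability.Distributions

namespace Literature.Computability.Cryptography

namespace BLPRS2013

namespace KProg

open Literature.Computability.Complexity Literature.Computability.Complexity.CodeFP Literature.Computability.QuantumComplexity
open Literature.Algebra.EuclideanLattices (encodeRat encodeRat_injective)

/-! ### Closed form and program -/

/-- `⌊κ̂G/2ᵇ⌉` in exact rational arithmetic. [cite: Peikert2009, p. 7] -/
def psiValueQ (κh : ℚ) (b : ℕ) (G : ℤ) : ℤ := round (κh * ((G : ℤ) : ℚ) / (((2 ^ b : ℕ) : ℤ) : ℚ))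

/-- The rational rounding is the law file's real rounding. [folklore] -/
theorem psiValueQ_eq_psiValue (κh : ℚ) (b : ℕ) (G : ℤ) : psiValueQ κh b G = psiValue (κh : ℝ) b G := by
  unfold psiValueQ psiValue
  rw [← Rat.round_cast (α := ℝ)]
  congr 1
  push_cast
  ring

/-- **One `Ψ̄` sample from the coins**: `G` by the flat pseudo-Gaussian sampler on the first `coinLen` coins, then `⌊κ̂G/2ᵇ⌉ mod Q` as a residue in `[0, Q)`.
[cite: BrakerskiEtAl2013, §5; Peikert2009, p. 7] -/
def psiFlat (Q : ℕ) (κh : ℚ) (b : ℕ) (PG : PGParams) (coins : List Bool) : ℕ :=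
  ((psiValueQ κh b (PG.samplerFlat (coins.take PG.coinLen))) % (Q : ℤ)).toNat

/-- **The sampler's record** `((Q, (κ̂, b)), (sampler context, coinLen))` and its code (`b`, `coinLen` unary). [folklore] -/
abbrev PRec : Type := (ℕ × (ℚ × ℕ)) × (SamplerCtx × ℕ)

/-- Its code. [folklore] -/
abbrev pRecE : PRec → List Bool := pairE (pairE natE (pairE encodeRat unE)) (pairE samplerCtxE unE)

/-- The genuine record. [folklore] -/
def pRecOf (Q : ℕ) (κh : ℚ) (b : ℕ) (PG : PGParams) : PRec := ((Q, (κh, b)), (PG.ctx, PG.coinLen))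

/-- **The sampler against the record.** [cite: BrakerskiEtAl2013, §5] -/
def psiOf (r : PRec) (coins : List Bool) : ℕ :=
  ((psiValueQ r.1.2.1 r.1.2.2 (samplerOf r.2.1 (coins.take r.2.2))) % (r.1.1 : ℤ)).toNat

/-- At the genuine record the program is the closed form. [folklore] -/
theorem psiOf_pRecOf (Q : ℕ) (κh : ℚ) (b : ℕ) (PG : PGParams) (coins : List Bool) :
    psiOf (pRecOf Q κh b PG) coins = psiFlat Q κh b PG coins := by
  simp [psiOf, psiFlat, pRecOf, samplerOf_ctx]

/-! ### Typed polynomial time -/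

section CodeFP

/-- `psiValueQ` is typed polynomial time in `((κ̂, b), G)`. [cite: AroraBarak2009, §1.3] -/
theorem psiValueQ_codeFP : CodeFP (pairE (pairE encodeRat unE) intE) intE (fun p => psiValueQ p.1.1 p.1.2 p.2) := by
  have hκ : CodeFP (pairE (pairE encodeRat unE) intE) encodeRat (fun p => p.1.1) := (fst _ _).fst'
  have hb : CodeFP (pairE (pairE encodeRat unE) intE) unE (fun p => p.1.2) := (fst _ _).snd'
  have hG : CodeFP (pairE (pairE encodeRat unE) intE) intE (fun p => p.2) := snd _ _
  have h2b : CodeFP (pairE (pairE encodeRat unE) intE) natE (fun p => 2 ^ p.1.2) := (natPow.comp ((const _ 2).pair hb) :)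
  have hq : CodeFP (pairE (pairE encodeRat unE) intE) encodeRat (fun p => p.1.1 * (((p.2 : ℤ) : ℚ) / (((2 ^ p.1.2 : ℕ) : ℤ) : ℚ))) :=
    (ratMul.comp (hκ.pair (ratOfIntNat.comp (hG.pair h2b))) :)
  exact ((ratRound.comp hq).congr fun p => by simp only [psiValueQ, mul_div_assoc])

/-- **The sampler is typed polynomial time** in `(record, coins)`. [cite: BrakerskiEtAl2013, §5; AroraBarak2009, §1.3] -/
theorem psiOf_codeFP : CodeFP (pairE pRecE strE) natE (fun p => psiOf p.1 p.2) := by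
  have hr : CodeFP (pairE pRecE strE) pRecE (fun p => p.1) := fst _ _
  have hc : CodeFP (pairE pRecE strE) strE (fun p => p.2) := snd _ _
  have hQ : CodeFP (pairE pRecE strE) natE (fun p => p.1.1.1) := hr.fst'.fst'
  have hκb : CodeFP (pairE pRecE strE) (pairE encodeRat unE) (fun p => p.1.1.2) := hr.fst'.snd'
  have hctx : CodeFP (pairE pRecE strE) samplerCtxE (fun p => p.1.2.1) := hr.snd'.fst'
  have hlen : CodeFP (pairE pRecE strE) unE (fun p => p.1.2.2) := hr.snd'.snd'
  have hG : CodeFP (pairE pRecE strE) intE (fun p => samplerOf p.1.2.1 (p.2.take p.1.2.2)) :=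
    (samplerOf_codeFP.comp (hctx.pair (strTake.comp (hlen.pair hc))) :)
  have hv : CodeFP (pairE pRecE strE) intE (fun p => psiValueQ p.1.1.2.1 p.1.1.2.2 (samplerOf p.1.2.1 (p.2.take p.1.2.2))) :=
    (psiValueQ_codeFP.comp (hκb.pair hG) :)
  have hQ' : CodeFP (pairE pRecE strE) intE (fun p => (p.1.1.1 : ℤ)) := (intOfNat.comp hQ :)
  have hmod : CodeFP (pairE pRecE strE) intE (fun p => psiValueQ p.1.1.2.1 p.1.1.2.2 (samplerOf p.1.2.1 (p.2.take p.1.2.2)) % (p.1.1.1 : ℤ)) :=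
    ((intSub.comp (hv.pair (intMul.comp (hQ'.pair (intEDiv.comp (hv.pair hQ')))))).congr fun p => by rw [Int.emod_def])
  exact ((intToNat.comp hmod).congr fun p => rfl)

end CodeFP

/-! ### The law on uniform coins -/

/-- **On uniform coins the sampler program has the law `psiLaw`** (read through `ZMod.val`), for coin strings of length `C ≥ coinLen`.
[cite: BrakerskiEtAl2013, §5; AroraBarak2009, Def. 7.1] -/
theorem uniformVector_map_psiFlat (Q : ℕ) [NeZero Q] (κh : ℚ) (b : ℕ) (PG : PGParams) {C : ℕ} (hC : PG.coinLen ≤ C) :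
    (uniformOfFintype (List.Vector Bool C)).map (fun v => psiFlat Q κh b PG v.toList) = (psiLaw Q (κh : ℝ) b PG.lawPMF).map ZMod.val := by
  classical
  have hfac : (fun v : List.Vector Bool C => psiFlat Q κh b PG v.toList) =
      (fun G : ℤ => ((psiValueQ κh b G) % (Q : ℤ)).toNat) ∘ (fun v : List.Vector Bool C => PG.samplerFlat (v.toList.take PG.coinLen)) := by
    funext v; rfl
  have hsam : (uniformOfFintype (List.Vector Bool C)).map (fun v : List.Vector Bool C => PG.samplerFlat (v.toList.take PG.coinLen)) = PG.lawPMF := by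
    have hfac₃ : (fun v : List.Vector Bool C => PG.samplerFlat (v.toList.take PG.coinLen)) =
        (fun pr : List.Vector Bool PG.coinLen × List.Vector Bool (C - PG.coinLen) => PG.samplerFlat pr.1.toList) ∘ vecSplit PG.coinLen C hC := by
      funext v; rfl
    rw [hfac₃, ← PMF.map_comp, uniformVector_map_vecSplit, uniformOfFintype_prod_eq_bind, PMF.map_bind]
    have : ∀ u : List.Vector Bool PG.coinLen,
        ((uniformOfFintype (List.Vector Bool (C - PG.coinLen))).map (Prod.mk u)).map
            (fun pr : List.Vector Bool PG.coinLen × List.Vector Bool (C - PG.coinLen) => PG.samplerFlat pr.1.toList) =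
          PMF.pure (PG.samplerFlat u.toList) := fun u => by
      rw [PMF.map_comp]
      exact PMF.map_const _ (PG.samplerFlat u.toList)
    simp_rw [this]
    rw [show (fun u : List.Vector Bool PG.coinLen => PMF.pure (PG.samplerFlat u.toList)) = PMF.pure ∘ (fun u : List.Vector Bool PG.coinLen => PG.samplerFlat u.toList)
      from rfl, PMF.bind_pure_comp]
    exact PGParams.uniformVector_map_samplerFlat_eq_lawPMF PG
  rw [hfac, ← PMF.map_comp, hsam, psiLaw, PMF.map_comp]
  congr 1
  funext G
  simp only [Function.comp_apply]
  rw [toNat_emod_eq_val (q := Q), psiValueQ_eq_psiValue]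

end KProg

end BLPRS2013

end Literature.Computability.Cryptography

end
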